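import Mathlib
import Summits.ValiantsHypothesis.ValiantsHypothesis.Theorems.DivisionGapPerMultiplesHardSpreadPatterns
import Summits.ValiantsHypothesis.ValiantsHypothesis.Theorems.DivisionGapPerMultiplesHardStubTypedDecompositionFifth
import Literature.Computability.AlgebraicComplexity.ArithCircuitProofs
import Literature.Computability.AlgebraicComplexity.PermanentIrreducible

/-!
# The relative spread engine (line `uncharged-face-walk` of crux `PerMultiplesHard`, route
DivisionGap; stubs `stub_spreadPatternsRel`, `stub_spreadPatternsColRel`)

Fix a row shift `ζ : Equiv.Perm (Fin n)`.  An exponent table `m` on the `n × n` variables is a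
`ζ`-SPREAD PROBE for the permutation `π` if every cell `(a, b)` of `m` has `π b = a ∨ π b = ζ a`.
The landed spread engine (`SpreadPatterns.spreadPatterns`) bounds the number of probed permutations
ABSOLUTELY (against `n!`).  Here is its RELATIVE (scale-free) form: for `n ≥ 5`, a
torus-homogeneous `g ∈ ℝ≥0[x_ij]` (all monomials share the row margins `R` and the column margins
`C`) with all rows hit, and ANY comparison set `P` of permutations, some typed rectangle `(S, T)`
with row support in the window `n < 5 · #S ≤ 2n` captures a `1 / L(g)` fraction of the probed part
of `P`:
`#{π ∈ P : supp g has a ζ-spread probe for π} ≤ L(g) · #{π ∈ P : π compatible with (S, T)}`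
(`L = complexity` over `ℝ≥0`).

Proof (`stub_spreadPatternsRel`): the typed decomposition `g = Σ_{t<s} a_t b_t`, `s ≤ L(g)`, every
`a_t` typed with row support in the window (`TypedDecompositionFifth.stub_typedDecompositionFifth`);
a probe of `a_t b_t` for `π` makes `π` compatible with the type of `a_t`
(`SpreadPatterns.spreadCompatible_of_probe`); hence the probed part of `P` lies in the union over `t`
of the compatible parts of `P` (`relCount_le_of_decomposition`), of total size at most
`s · max_t ≤ L(g) · max_t`; take a maximising `t` (`Finset.exists_max_image`).  If `s = 0` then
`g = 0`, nothing is probed, and any window set (`exists_window_set`) with `T = ∅` will do.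
The column form (`stub_spreadPatternsColRel`) is the row form for `rename Prod.swap g` (margins
exchanged, same complexity by `complexity_rename_of_injective_holds`, and the column probes of `g`
are row probes of the transpose), exactly as `SpreadPatterns.spreadPatternsCol` is derived from
`SpreadPatterns.spreadPatterns`.

-- adapted from Theorems/DivisionGapPerMultiplesHardSpreadPatterns.lean (`spreadCount_le_of_decomposition`,
`spreadPatterns`, `spreadPatternsCol`, with `Finset.univ` replaced by the comparison set `P`)
-/

noncomputable section

-- the namespace `Summit.ValiantsHypothesis.ValiantsHypothesis.…` is mandated by the crux (registered stub names)
set_option linter.dupNamespace false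

namespace Summit.ValiantsHypothesis.ValiantsHypothesis.Theorems.DivisionGap.PerMultiplesHard.SpreadPatternsRel

open MvPolynomial Literature.Computability.AlgebraicComplexity
open scoped NNReal BigOperators

/-- **A window set exists.**  For `n ≥ 5` there is a set `S` of rows with `n < 5 · #S ≤ 2n`: any
`⌊n/5⌋ + 1` rows (`5(⌊n/5⌋ + 1) > n` and `5(⌊n/5⌋ + 1) ≤ n + 5 ≤ 2n`). [folklore] -/
theorem exists_window_set (n : ℕ) (hn : 5 ≤ n) :
    ∃ S : Finset (Fin n), n < 5 * S.card ∧ 5 * S.card ≤ 2 * n := by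
  classical
  have hle : n / 5 + 1 ≤ (Finset.univ : Finset (Fin n)).card := by
    rw [Finset.card_univ, Fintype.card_fin]; omega
  obtain ⟨S, -, hS⟩ := Finset.exists_subset_card_eq hle
  exact ⟨S, by rw [hS]; omega, by rw [hS]; omega⟩

/-- **The relative counting lemma.**  If `g = Σ_{t<s} a_t · b_t`, then inside any comparison set `P`
the permutations with a `ζ`-spread probe in `supp g` are at most the sum over `t` of the numbers of
permutations of `P` with a `ζ`-spread probe in `supp (a_t · b_t)`: only `supp (Σ) ⊆ ⋃ supp` and
`#(⋃) ≤ Σ #` are used. [folklore] -/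
theorem relCount_le_of_decomposition {n s : ℕ} (ζ : Equiv.Perm (Fin n))
    (g : MvPolynomial (Fin n × Fin n) ℝ≥0) (a b : Fin s → MvPolynomial (Fin n × Fin n) ℝ≥0)
    (hg : g = ∑ t, a t * b t) (P : Finset (Equiv.Perm (Fin n))) :
    (P.filter fun π => ∃ m ∈ g.support, ∀ e ∈ m.support, π e.2 = e.1 ∨ π e.2 = ζ e.1).card ≤
      ∑ t, (P.filter fun π =>
        ∃ m ∈ (a t * b t).support, ∀ e ∈ m.support, π e.2 = e.1 ∨ π e.2 = ζ e.1).card := by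
  classical
  have h1 : (P.filter fun π => ∃ m ∈ g.support, ∀ e ∈ m.support, π e.2 = e.1 ∨ π e.2 = ζ e.1) ⊆
      Finset.univ.biUnion fun t => P.filter fun π =>
        ∃ m ∈ (a t * b t).support, ∀ e ∈ m.support, π e.2 = e.1 ∨ π e.2 = ζ e.1 := by
    intro π hπ
    obtain ⟨hπP, m, hmg, hprobe⟩ := Finset.mem_filter.mp hπ
    rw [hg] at hmg
    obtain ⟨t, -, ht⟩ := Finset.mem_biUnion.mp (MvPolynomial.support_sum hmg)
    exact Finset.mem_biUnion.mpr ⟨t, Finset.mem_univ t, Finset.mem_filter.mpr ⟨hπP, m, ht, hprobe⟩⟩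
  exact (Finset.card_le_card h1).trans Finset.card_biUnion_le

/-- **The maximising type.**  If `g = Σ_{t<s} a_t · b_t` with `s > 0` and, inside the comparison set
`P`, every permutation with a `ζ`-spread probe in `supp (a_t · b_t)` is compatible with the rectangle
`(S_t, T_t)`, then for some index `t₀` the probed part of `P` (probes in `supp g`) has size at most
`s` times the part of `P` compatible with `(S_{t₀}, T_{t₀})`: bound the relative count by the sum of
the compatible parts (`relCount_le_of_decomposition`) and the sum by `s · max`
(`Finset.exists_max_image`). [folklore] -/
theorem relCount_le_mul_max {n s : ℕ} (hs0 : 0 < s) (ζ : Equiv.Perm (Fin n))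
    (g : MvPolynomial (Fin n × Fin n) ℝ≥0) (a b : Fin s → MvPolynomial (Fin n × Fin n) ℝ≥0)
    (hg : g = ∑ t, a t * b t) (S T : Fin s → Finset (Fin n)) (P : Finset (Equiv.Perm (Fin n)))
    (hK : ∀ t, (P.filter fun π =>
        ∃ m ∈ (a t * b t).support, ∀ e ∈ m.support, π e.2 = e.1 ∨ π e.2 = ζ e.1) ⊆
      P.filter fun π => (∀ i ∈ S t, π.symm i ∈ T t ∨ π.symm (ζ i) ∈ T t) ∧
        (∀ j ∈ T t, π j ∈ S t ∨ ∃ i ∈ S t, ζ i = π j)) :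
    ∃ t₀ : Fin s,
      (P.filter fun π => ∃ m ∈ g.support, ∀ e ∈ m.support, π e.2 = e.1 ∨ π e.2 = ζ e.1).card ≤
        s * (P.filter fun π => (∀ i ∈ S t₀, π.symm i ∈ T t₀ ∨ π.symm (ζ i) ∈ T t₀) ∧
          (∀ j ∈ T t₀, π j ∈ S t₀ ∨ ∃ i ∈ S t₀, ζ i = π j)).card := by
  classical
  -- the compatible part of `P` for the type `t`
  set F : Fin s → ℕ := fun t => (P.filter fun π : Equiv.Perm (Fin n) =>
    (∀ i ∈ S t, π.symm i ∈ T t ∨ π.symm (ζ i) ∈ T t) ∧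
      (∀ j ∈ T t, π j ∈ S t ∨ ∃ i ∈ S t, ζ i = π j)).card with hF
  obtain ⟨t₀, -, ht₀⟩ :=
    Finset.exists_max_image (Finset.univ : Finset (Fin s)) F ⟨⟨0, hs0⟩, Finset.mem_univ _⟩
  refine ⟨t₀, ?_⟩
  calc (P.filter fun π => ∃ m ∈ g.support, ∀ e ∈ m.support, π e.2 = e.1 ∨ π e.2 = ζ e.1).card
      ≤ ∑ t, (P.filter fun π =>
          ∃ m ∈ (a t * b t).support, ∀ e ∈ m.support, π e.2 = e.1 ∨ π e.2 = ζ e.1).card :=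
        relCount_le_of_decomposition ζ g a b hg P
    _ ≤ ∑ t, F t := Finset.sum_le_sum fun t _ => Finset.card_le_card (hK t)
    _ ≤ ∑ _t : Fin s, F t₀ := Finset.sum_le_sum fun t _ => ht₀ t (Finset.mem_univ t)
    _ = s * F t₀ := by rw [Finset.sum_const, Finset.card_univ, Fintype.card_fin, smul_eq_mul]
    _ = _ := by rw [hF]

/-- **stub_spreadPatternsRel — the relative spread engine, rows.**  For `n ≥ 5`, a row shift `ζ`, a
torus-homogeneous `g` (margins `(R, C)`) with all rows hit and ANY comparison set `P` of
permutations, some typed rectangle `(S, T)` with row support in the window `n < 5 · #S ≤ 2n` has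
`#{π ∈ P : supp g has a ζ-spread probe for π} ≤ L(g) · #{π ∈ P : π compatible with (S, T)}`.
Proof: `stub_typedDecompositionFifth` gives `g = Σ_{t<s} a_t b_t`, `s ≤ L(g)`, `a_t` typed in the
window; a probe of `a_t b_t` for `π` makes `π` compatible with the type of `a_t`
(`SpreadPatterns.spreadCompatible_of_probe`); so the probed part of `P` lies in the union over `t`
of the compatible parts of `P`, of total size `≤ s · max_t` (`relCount_le_mul_max`).  If `s = 0`
then `g = 0`, the probed set is empty, and any window set (`exists_window_set`) with `T = ∅` will
do. [folklore] -/
theorem stub_spreadPatternsRel :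
    ∀ n ≥ 5, ∀ (ζ : Equiv.Perm (Fin n)) (g : MvPolynomial (Fin n × Fin n) ℝ≥0) (R C : Fin n → ℕ),
      (∀ m ∈ g.support, (∀ i, ∑ j, m (i, j) = R i) ∧ (∀ j, ∑ i, m (i, j) = C j)) →
      (∀ i, R i ≠ 0) →
      ∀ P : Finset (Equiv.Perm (Fin n)), ∃ S T : Finset (Fin n),
        n < 5 * S.card ∧ 5 * S.card ≤ 2 * n ∧
        (P.filter fun π => ∃ m ∈ g.support, ∀ e ∈ m.support, π e.2 = e.1 ∨ π e.2 = ζ e.1).card ≤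
          complexity g *
            (P.filter fun π => (∀ i ∈ S, π.symm i ∈ T ∨ π.symm (ζ i) ∈ T) ∧
              (∀ j ∈ T, π j ∈ S ∨ ∃ i ∈ S, ζ i = π j)).card := by
  classical
  intro n hn ζ g R C hg hR P
  obtain ⟨s, hs, a, b, hgab, htyp⟩ :=
    Summit.ValiantsHypothesis.ValiantsHypothesis.Theorems.DivisionGap.PerMultiplesHard.TypedDecompositionFifth.stub_typedDecompositionFifth
      n hn g R C hg hR
  rcases Nat.eq_zero_or_pos s with rfl | hs0
  · -- `g = Σ_{t ∈ Fin 0} a_t b_t = 0`: nothing is probed; any window set will do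
    obtain ⟨S, hlo, hhi⟩ := exists_window_set n hn
    refine ⟨S, ∅, hlo, hhi, ?_⟩
    have hg0 : g = 0 := by rw [hgab]; exact Fin.sum_univ_zero _
    have hempty : (P.filter fun π =>
        ∃ m ∈ g.support, ∀ e ∈ m.support, π e.2 = e.1 ∨ π e.2 = ζ e.1) = ∅ := by
      refine Finset.filter_eq_empty_iff.mpr ?_
      rintro π - ⟨m, hm, -⟩
      rw [hg0, MvPolynomial.support_zero] at hm
      exact Finset.notMem_empty _ hm
    rw [hempty, Finset.card_empty]
    exact Nat.zero_le _
  · -- `s > 0`: choose the types; a probe of `a_t b_t` forces compatibility with the type of `a_t`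
    choose ρ γ hty hlo hhi using htyp
    obtain ⟨t₀, ht₀⟩ := relCount_le_mul_max hs0 ζ g a b hgab
      (fun t => Finset.univ.filter fun i => ρ t i ≠ 0) (fun t => Finset.univ.filter fun j => γ t j ≠ 0) P
      (fun t π hπ => by
        obtain ⟨hπP, m, hm, hprobe⟩ := Finset.mem_filter.mp hπ
        exact Finset.mem_filter.mpr
          ⟨hπP, SpreadPatterns.spreadCompatible_of_probe hm π hprobe (hty t)⟩)
    exact ⟨_, _, hlo t₀, hhi t₀, ht₀.trans (Nat.mul_le_mul_right _ hs)⟩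

/-- **stub_spreadPatternsColRel — the relative spread engine, columns.**  The transpose of
`stub_spreadPatternsRel`: for `n ≥ 5`, every shift `ζ`, every torus-homogeneous `g` all of whose
COLUMNS are hit and any comparison set `P`, some typed rectangle `(S, T)` with `n < 5 · #S ≤ 2n` has
`#{π ∈ P : supp g has a ζ-column probe for π} ≤ L(g) · #{π ∈ P : π compatible with (S, T)}`
(a `ζ`-COLUMN probe: every cell `(a, b)` has `π a = b ∨ π a = ζ b`; the compatibility formula is
the one of the row statement).  Proof: the row statement for `rename Prod.swap g`, whose monomials
are the transposes (margins exchanged), whose complexity is the same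
(`complexity_rename_of_injective_holds`) and whose row probes for `π` include the transposes of the
column probes of `g`. [folklore] -/
theorem stub_spreadPatternsColRel :
    ∀ n ≥ 5, ∀ (ζ : Equiv.Perm (Fin n)) (g : MvPolynomial (Fin n × Fin n) ℝ≥0) (R C : Fin n → ℕ),
      (∀ m ∈ g.support, (∀ i, ∑ j, m (i, j) = R i) ∧ (∀ j, ∑ i, m (i, j) = C j)) →
      (∀ j, C j ≠ 0) →
      ∀ P : Finset (Equiv.Perm (Fin n)), ∃ S T : Finset (Fin n),
        n < 5 * S.card ∧ 5 * S.card ≤ 2 * n ∧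
        (P.filter fun π => ∃ m ∈ g.support, ∀ e ∈ m.support, π e.1 = e.2 ∨ π e.1 = ζ e.2).card ≤
          complexity g *
            (P.filter fun π => (∀ i ∈ S, π.symm i ∈ T ∨ π.symm (ζ i) ∈ T) ∧
              (∀ j ∈ T, π j ∈ S ∨ ∃ i ∈ S, ζ i = π j)).card := by
  classical
  intro n hn ζ g R C hg hC P
  have hsw : Function.Injective (Prod.swap : Fin n × Fin n → Fin n × Fin n) := Prod.swap_injective
  set gT : MvPolynomial (Fin n × Fin n) ℝ≥0 := rename Prod.swap g with hgT
  have hsupp : gT.support = g.support.image (Finsupp.mapDomain Prod.swap) :=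
    MvPolynomial.support_rename_of_injective hsw
  have happ : ∀ (m : (Fin n × Fin n) →₀ ℕ) (a b : Fin n),
      Finsupp.mapDomain Prod.swap m (a, b) = m (b, a) := by
    intro m a b
    have : ((a, b) : Fin n × Fin n) = Prod.swap (b, a) := rfl
    rw [this, Finsupp.mapDomain_apply hsw]
  -- margins of the transpose
  have hgT' : ∀ m ∈ gT.support, (∀ i, ∑ j, m (i, j) = C i) ∧ (∀ j, ∑ i, m (i, j) = R j) := by
    intro m' hm'
    rw [hsupp, Finset.mem_image] at hm'
    obtain ⟨m, hm, rfl⟩ := hm'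
    obtain ⟨hr, hc⟩ := hg m hm
    refine ⟨fun i => ?_, fun j => ?_⟩
    · rw [← hc i]; exact Finset.sum_congr rfl fun j _ => happ m i j
    · rw [← hr j]; exact Finset.sum_congr rfl fun i _ => happ m i j
  obtain ⟨S, T, hlo, hhi, heng⟩ := stub_spreadPatternsRel n hn ζ gT C R hgT' hC P
  have hcx : complexity gT = complexity g := complexity_rename_of_injective_holds hsw g
  refine ⟨S, T, hlo, hhi, ?_⟩
  -- column probes of `g` are row probes of `gT`
  have hle : (P.filter fun π =>
        ∃ m ∈ g.support, ∀ e ∈ m.support, π e.1 = e.2 ∨ π e.1 = ζ e.2).card ≤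
      (P.filter fun π =>
        ∃ m ∈ gT.support, ∀ e ∈ m.support, π e.2 = e.1 ∨ π e.2 = ζ e.1).card := by
    refine Finset.card_le_card fun π hπ => ?_
    obtain ⟨hπP, M, hM, hprobe⟩ := Finset.mem_filter.mp hπ
    refine Finset.mem_filter.mpr ⟨hπP, Finsupp.mapDomain Prod.swap M, ?_, ?_⟩
    · rw [hsupp]; exact Finset.mem_image_of_mem _ hM
    · intro e he
      rw [Finsupp.mapDomain_support_of_injective hsw, Finset.mem_image] at he
      obtain ⟨e₀, he₀, rfl⟩ := he
      simpa [Prod.fst_swap, Prod.snd_swap] using hprobe e₀ he₀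
  calc (P.filter fun π =>
          ∃ m ∈ g.support, ∀ e ∈ m.support, π e.1 = e.2 ∨ π e.1 = ζ e.2).card
      ≤ (P.filter fun π =>
          ∃ m ∈ gT.support, ∀ e ∈ m.support, π e.2 = e.1 ∨ π e.2 = ζ e.1).card := hle
    _ ≤ complexity gT * (P.filter fun π => (∀ i ∈ S, π.symm i ∈ T ∨ π.symm (ζ i) ∈ T) ∧
          (∀ j ∈ T, π j ∈ S ∨ ∃ i ∈ S, ζ i = π j)).card := heng
    _ = complexity g * (P.filter fun π => (∀ i ∈ S, π.symm i ∈ T ∨ π.symm (ζ i) ∈ T) ∧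
          (∀ j ∈ T, π j ∈ S ∨ ∃ i ∈ S, ζ i = π j)).card := by rw [hcx]

end Summit.ValiantsHypothesis.ValiantsHypothesis.Theorems.DivisionGap.PerMultiplesHard.SpreadPatternsRel

end
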